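import Summits.KontsevichZagierPeriods.KontsevichZagierPeriods.Theorems.SoloInformedCurveSector
import Summits.KontsevichZagierPeriods.KontsevichZagierPeriods.Theorems.SoloInformedCurveSectorFibre
import Summits.KontsevichZagierPeriods.KontsevichZagierPeriods.Theorems.SoloInformedPolyJacobian

/-!
# Polynomial weights enter the curve sector by a polynomial shear (Theorem XVI-P)

Solo programme `solo-KontsevichZagierPeriods-informed`, session s32, line "the curve sector"
(`SoloInformedCurveSector.lean`, Theorem XV: granted Huber–Wüstholz, two representations of any
dimensions whose `Per` lies in `soloInformedKappaSpan` and whose values agree are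
Kontsevich–Zagier equivalent; `SoloInformedCurveSectorFibre.lean`, Theorem XVI-K: a volume
representation `[S, 1]` lies in the sector as soon as all its fibre-length representations
`[C, L_S]` one dimension down do).

This file puts **polynomially weighted planar integrals** into the sector.

* `soloInformed_per_mem_span_poly` — **THEOREM XVI-P.** For `r = [D, p]` with `D ⊆ ℝ²` bounded
  `ℚ`-semialgebraic and `p ∈ ℚ[x, y]`, `Per r ∈ soloInformedKappaSpan`. The proof is ONE
  change of variables (rule (2) of [KZ 2001, §1.2]) instead of a weighted Newton–Leibniz descent:
  choose `M ∈ ℕ` with `|p| < M` on a box containing `D` and `P ∈ ℚ[x, y]` with `∂P/∂y = p + M`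
  (`soloInformed_exists_pderiv_eq`); the polynomial shear `Φ(x, y) = (x, P(x, y))` is injective on
  `D` (`P(x, ·)` is strictly increasing on the box) with Jacobian `p + M > 0`, so
  `[D, p + M] ≡ [Φ(D), 1]` is the AREA of a bounded planar `ℚ`-semialgebraic set, which is in the
  sector by Rung 2 (`soloInformed_per_mem_span_planar`, after passing to the compact closure,
  `soloInformed_per_mem_span_planar_of_isBounded`); likewise `[D, M] ≡ [(x, M y)(D), 1]`, and
  `[D, p] = [D, p + M] − [D, M]` by rule (1).
* `soloInformed_per_mem_span_piecewisePoly` — the same for integrands that are piecewise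
  polynomial on finitely many bounded `ℚ`-semialgebraic pieces and `0` elsewhere.
* `soloInformed_per_mem_span_poly_on` — one bounded piece, `0` elsewhere.

The three-dimensional consequences (solids with piecewise-polynomial vertical fibre length are in
the curve sector; Rung 3 of the volume ladder on that class, granted Huber–Wüstholz) are drawn in
the companion file `SoloInformedCurveSectorPolySolids.lean`.

References: M. Kontsevich, D. Zagier, *Periods* (2001), §1.2, rules (1)–(3)
[KontsevichZagier2001]; A. Huber, G. Wüstholz, *Transcendence and linear relations of
1-periods*, CUP 2022, Thm. 13.3 [HuberWuestholz2022].
-/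

noncomputable section

open MeasureTheory Set
open Literature.ModelTheory.ExponentialFields Literature.NumberTheory.Transcendental
open Literature.NumberTheory.Transcendental.KZ

namespace Summit.KontsevichZagierPeriods.KontsevichZagierPeriods.Theorems

/-! ## 1. Polynomial antiderivatives, boxes, bounds -/

/-- Every polynomial over `ℚ` has a polynomial antiderivative in any variable. -/
theorem soloInformed_exists_pderiv_eq {σ : Type*} (i : σ) (p : MvPolynomial σ ℚ) :
    ∃ P : MvPolynomial σ ℚ, MvPolynomial.pderiv i P = p := by
  classical
  induction p using MvPolynomial.induction_on' with
  | monomial u a =>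
    refine ⟨MvPolynomial.monomial (u + Finsupp.single i 1) (a / ((u i : ℚ) + 1)), ?_⟩
    rw [MvPolynomial.pderiv_monomial, add_tsub_cancel_right]
    congr 1
    rw [Finsupp.add_apply, Finsupp.single_eq_same, Nat.cast_add, Nat.cast_one]
    have h : ((u i : ℚ) + 1) ≠ 0 := by positivity
    field_simp
  | add p q hp hq =>
    obtain ⟨P, hP⟩ := hp
    obtain ⟨Q, hQ⟩ := hq
    exact ⟨P + Q, by rw [map_add, hP, hQ]⟩

/-- A bounded set lies in a coordinate box `{z | ∀ i, |z i| ≤ R}`, `R ≥ 0`. -/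
theorem soloInformed_exists_abs_le_of_isBounded {n : ℕ} {D : Set (Fin n → ℝ)}
    (hb : Bornology.IsBounded D) : ∃ R : ℝ, 0 ≤ R ∧ ∀ z ∈ D, ∀ i, |z i| ≤ R := by
  obtain ⟨C, hC⟩ := isBounded_iff_forall_norm_le.mp hb
  refine ⟨max C 0, le_max_right _ _, fun z hz i => ?_⟩
  have h := norm_le_pi_norm z i
  rw [Real.norm_eq_abs] at h
  exact h.trans ((hC z hz).trans (le_max_left _ _))

/-- The coordinate box is an order interval of `ℝⁿ`. -/
theorem soloInformed_box_eq_Icc {n : ℕ} (R : ℝ) :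
    {z : Fin n → ℝ | ∀ i, |z i| ≤ R} = Icc (fun _ => -R) (fun _ => R) := by
  ext z
  simp only [mem_setOf_eq, mem_Icc, Pi.le_def, abs_le]
  exact ⟨fun h => ⟨fun i => (h i).1, fun i => (h i).2⟩, fun h i => ⟨h.1 i, h.2 i⟩⟩

/-- The coordinate box is compact. -/
theorem soloInformed_isCompact_box {n : ℕ} (R : ℝ) :
    IsCompact {z : Fin n → ℝ | ∀ i, |z i| ≤ R} := by
  rw [soloInformed_box_eq_Icc]
  exact isCompact_Icc

/-- Polynomial functions are continuous (from `soloInformed_hasFDerivAt_aeval`). -/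
theorem soloInformed_continuous_aeval_of_hasFDerivAt {n : ℕ} (q : MvPolynomial (Fin n) ℚ) :
    Continuous fun z : Fin n → ℝ => (MvPolynomial.aeval z q : ℝ) :=
  continuous_iff_continuousAt.2 fun z => (soloInformed_hasFDerivAt_aeval q z).continuousAt

/-- A polynomial is bounded by a natural number on a coordinate box. -/
theorem soloInformed_exists_nat_bound_aeval {n : ℕ} (p : MvPolynomial (Fin n) ℚ) (R : ℝ) :
    ∃ M : ℕ, ∀ z : Fin n → ℝ, (∀ i, |z i| ≤ R) → |(MvPolynomial.aeval z p : ℝ)| < M := by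
  obtain ⟨C, hC⟩ := (soloInformed_isCompact_box (n := n) R).exists_bound_of_continuousOn
    (soloInformed_continuous_aeval_of_hasFDerivAt p).continuousOn
  refine ⟨⌈C⌉₊ + 1, fun z hz => ?_⟩
  have h := hC z hz
  rw [Real.norm_eq_abs] at h
  calc |(MvPolynomial.aeval z p : ℝ)| ≤ C := h
    _ ≤ ⌈C⌉₊ := Nat.le_ceil C
    _ < (⌈C⌉₊ : ℝ) + 1 := lt_add_one _
    _ = ((⌈C⌉₊ + 1 : ℕ) : ℝ) := by push_cast; ring

/-! ## 2. Bounded planar volumes are in the sector -/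

/-- **Areas of bounded planar sets are in the curve sector** (no compactness): pass to the compact
closure, a null modification (`exists_closure_of_integrand_one`), then Rung 2
(`soloInformed_per_mem_span_planar`). -/
theorem soloInformed_per_mem_span_planar_of_isBounded (r : IntegralRep 2)
    (hb : Bornology.IsBounded r.domain) (hr1 : ∀ x ∈ r.domain, r.integrand x = 1) :
    soloInformedPer r ∈ soloInformedKappaSpan := by
  obtain ⟨K, -, hKi, hKc, -, hrel⟩ := exists_closure_of_integrand_one r hr1 hb
  rw [soloInformedPer_congr hrel]
  exact soloInformed_per_mem_span_planar K hKc fun x _ => by rw [hKi]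

/-! ## 3. The polynomial shear `Φ(x, y) = (x, P(x, y))` -/

/-- Derivative of a polynomial along the vertical line `s ↦ (z₀, s)`. -/
theorem soloInformed_hasDerivAt_aeval_update (P : MvPolynomial (Fin 2) ℚ) (z : Fin 2 → ℝ)
    (t : ℝ) :
    HasDerivAt (fun s : ℝ => (MvPolynomial.aeval (Function.update z 1 s) P : ℝ))
      (MvPolynomial.aeval (Function.update z 1 t) (MvPolynomial.pderiv 1 P)) t := by
  have h := (soloInformed_hasFDerivAt_aeval P (Function.update z 1 t)).comp_hasDerivAt t
    (hasDerivAt_update z 1 t)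
  rw [soloInformedGradCLM_apply, Fin.sum_univ_two] at h
  exact h.congr_deriv (by simp)

/-- `P(z₀, ·)` is strictly increasing on an interval where `∂P/∂y > 0`. -/
theorem soloInformed_strictMonoOn_aeval_update (P : MvPolynomial (Fin 2) ℚ) (z : Fin 2 → ℝ)
    {a b : ℝ} (hpos : ∀ t ∈ Icc a b,
      0 < (MvPolynomial.aeval (Function.update z 1 t) (MvPolynomial.pderiv 1 P) : ℝ)) :
    StrictMonoOn (fun s : ℝ => (MvPolynomial.aeval (Function.update z 1 s) P : ℝ)) (Icc a b) := by
  refine strictMonoOn_of_deriv_pos (convex_Icc a b) ?_ fun t ht => ?_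
  · exact HasDerivAt.continuousOn fun t _ => soloInformed_hasDerivAt_aeval_update P z t
  · rw [(soloInformed_hasDerivAt_aeval_update P z t).deriv]
    exact hpos t (interior_subset ht)

/-- **The shear is injective** on any set inside a box on which `∂P/∂y > 0`. -/
theorem soloInformed_injOn_shear (P : MvPolynomial (Fin 2) ℚ) {D : Set (Fin 2 → ℝ)} {R : ℝ}
    (hD : ∀ z ∈ D, ∀ i, |z i| ≤ R)
    (hpos : ∀ z : Fin 2 → ℝ, (∀ i, |z i| ≤ R) →
      0 < (MvPolynomial.aeval z (MvPolynomial.pderiv 1 P) : ℝ)) :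
    InjOn (soloInformedPolyMap ![MvPolynomial.X 0, P]) D := by
  intro z hz w hw hzw
  have h0 : z 0 = w 0 := by simpa using congr_fun hzw 0
  have h1 : (MvPolynomial.aeval z P : ℝ) = MvPolynomial.aeval w P := by
    simpa using congr_fun hzw 1
  -- `w` lies on the vertical line through `z`
  have hw' : w = Function.update z 1 (w 1) := by
    ext i
    fin_cases i
    · simp [h0]
    · simp
  have hz' : z = Function.update z 1 (z 1) := by simp
  -- the vertical segment of the box through `z` lies in the box
  have hline : ∀ t ∈ Icc (-R) R, ∀ i, |Function.update z 1 t i| ≤ R := by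
    intro t ht i
    fin_cases i
    · simpa using hD z hz 0
    · simpa using abs_le.2 ⟨ht.1, ht.2⟩
  have hmono := soloInformed_strictMonoOn_aeval_update P z (a := -R) (b := R)
    fun t ht => hpos _ (hline t ht)
  have hzI : z 1 ∈ Icc (-R) R := abs_le.1 (hD z hz 1)
  have hwI : w 1 ∈ Icc (-R) R := abs_le.1 (hD w hw 1)
  have heq : (MvPolynomial.aeval (Function.update z 1 (z 1)) P : ℝ) =
      MvPolynomial.aeval (Function.update z 1 (w 1)) P := by rw [← hz', h1, ← hw']
  have h11 : z 1 = w 1 := hmono.injOn hzI hwI heq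
  rw [hw', ← h11, ← hz']

/-- **The Jacobian of the shear is `∂P/∂y`.** -/
theorem soloInformed_det_shear (P : MvPolynomial (Fin 2) ℚ) (z : Fin 2 → ℝ) :
    (soloInformedJacCLM ![MvPolynomial.X 0, P] z).det =
      MvPolynomial.aeval z (MvPolynomial.pderiv 1 P) := by
  rw [soloInformed_det_jacCLM, Matrix.det_fin_two]
  simp [soloInformedJacMat_apply, MvPolynomial.pderiv_X]

/-- **The shear move.** If `r = [D, ∂P/∂y]` with `D` inside a box on which `∂P/∂y > 0`, then
`Per r` lies in the curve sector: rule (2) for `Φ(x, y) = (x, P(x, y))` gives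
`[D, ∂P/∂y] ≡ [Φ(D), 1]`, the area of a bounded planar `ℚ`-semialgebraic set.
[Kontsevich–Zagier 2001, §1.2, rule (2)] -/
theorem soloInformed_per_mem_span_of_pderiv_pos (r : IntegralRep 2) (P : MvPolynomial (Fin 2) ℚ)
    {R : ℝ} (hD : ∀ z ∈ r.domain, ∀ i, |z i| ≤ R)
    (hpos : ∀ z : Fin 2 → ℝ, (∀ i, |z i| ≤ R) →
      0 < (MvPolynomial.aeval z (MvPolynomial.pderiv 1 P) : ℝ))
    (hr : ∀ z ∈ r.domain, r.integrand z = MvPolynomial.aeval z (MvPolynomial.pderiv 1 P)) :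
    soloInformedPer r ∈ soloInformedKappaSpan := by
  have hsa : IsSemialgebraicMapOn ℚ r.domain (soloInformedPolyMap ![MvPolynomial.X 0, P]) :=
    isSemialgebraicMapOn_aeval r.isSemialgebraic_domain ![MvPolynomial.X 0, P]
  have hIm : IsSemialgebraic ℚ (soloInformedPolyMap ![MvPolynomial.X 0, P] '' r.domain) :=
    IsSemialgebraicMapOn.isSemialgebraic_image_holds hsa Subset.rfl r.isSemialgebraic_domain
  have hΦc : Continuous (soloInformedPolyMap ![MvPolynomial.X 0, P]) :=
    continuous_iff_continuousAt.2 fun u =>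
      (soloInformed_hasFDerivAt_polyMap ![MvPolynomial.X 0, P] u).continuousAt
  have hsub : r.domain ⊆ {z : Fin 2 → ℝ | ∀ i, |z i| ≤ R} := fun z hz => hD z hz
  have hbd : Bornology.IsBounded (soloInformedPolyMap ![MvPolynomial.X 0, P] '' r.domain) :=
    ((soloInformed_isCompact_box R).image hΦc).isBounded.subset (image_mono hsub)
  let r' : IntegralRep 2 := ⟨soloInformedPolyMap ![MvPolynomial.X 0, P] '' r.domain, fun _ => 1,
    hIm, by simpa using isSemialgebraicFunOn_ratCast hIm 1,
    integrableOn_const hbd.measure_lt_top.ne⟩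
  have hrel : of r - of r' ∈ relations := by
    refine changeOfVariablesRel_subset_relations ⟨2, r, r',
      soloInformedPolyMap ![MvPolynomial.X 0, P], soloInformedJacCLM ![MvPolynomial.X 0, P], hsa,
      fun u _ => (soloInformed_hasFDerivAt_polyMap _ u).hasFDerivWithinAt,
      soloInformed_injOn_shear P hD hpos, rfl, fun u hu => ?_, rfl⟩
    show r.integrand u = 1 * |(soloInformedJacCLM ![MvPolynomial.X 0, P] u).det|
    rw [soloInformed_det_shear, abs_of_pos (hpos u (hD u hu)), one_mul, hr u hu]
  rw [soloInformedPer_congr hrel]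
  exact soloInformed_per_mem_span_planar_of_isBounded r' hbd fun _ _ => rfl

/-! ## 4. THEOREM XVI-P — polynomial weights on bounded planar sets -/

/-- **THEOREM XVI-P.** For a representation `r = [D, p]` of dimension two with `D` bounded
(`ℚ`-semialgebraic) and integrand a polynomial `p ∈ ℚ[x, y]` on `D`, `Per r` lies in the curve
sector `soloInformedKappaSpan`. Proof: `[D, p] = [D, p + M] − [D, M]` (rule (1)) with `M ∈ ℕ`,
`|p| < M` on a box containing `D`; both terms are shear moves
(`soloInformed_per_mem_span_of_pderiv_pos` with `∂P/∂y = p + M`, resp. `P = M y`).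
[Kontsevich–Zagier 2001, §1.2, rules (1), (2)] -/
theorem soloInformed_per_mem_span_poly (r : IntegralRep 2) (hb : Bornology.IsBounded r.domain)
    (p : MvPolynomial (Fin 2) ℚ) (hr : ∀ z ∈ r.domain, r.integrand z = MvPolynomial.aeval z p) :
    soloInformedPer r ∈ soloInformedKappaSpan := by
  classical
  obtain ⟨R, hR0, hR⟩ := soloInformed_exists_abs_le_of_isBounded hb
  obtain ⟨M, hM⟩ := soloInformed_exists_nat_bound_aeval p R
  have hM0 : (0 : ℝ) < M :=
    (abs_nonneg _).trans_lt (hM 0 fun i => by simpa using hR0)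
  obtain ⟨P, hP⟩ := soloInformed_exists_pderiv_eq (1 : Fin 2) (p + MvPolynomial.C (M : ℚ))
  have hsub : r.domain ⊆ {z : Fin 2 → ℝ | ∀ i, |z i| ≤ R} := fun z hz => hR z hz
  have hK := soloInformed_isCompact_box (n := 2) R
  have hfin : volume r.domain ≠ ⊤ := hb.measure_lt_top.ne
  -- `[D, p + M]` and `[D, M]`
  let rq : IntegralRep 2 := ⟨r.domain,
    fun z => (MvPolynomial.aeval z (p + MvPolynomial.C (M : ℚ)) : ℝ), r.isSemialgebraic_domain,
    isSemialgebraicFunOn_aeval r.isSemialgebraic_domain _,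
    ((soloInformed_continuous_aeval_of_hasFDerivAt _).continuousOn.integrableOn_compact hK).mono_set hsub⟩
  let rM : IntegralRep 2 := ⟨r.domain, fun _ => (M : ℝ), r.isSemialgebraic_domain,
    isSemialgebraicFunOn_natCast r.isSemialgebraic_domain M, integrableOn_const hfin⟩
  have hadd : of rq - of r - of rM ∈ relations :=
    integrandAddRel_subset_relations ⟨2, rq, r, rM, rfl, rfl, fun z hz => by
      simp [rq, rM, hr z hz], rfl⟩
  have hq : soloInformedPer rq ∈ soloInformedKappaSpan := by
    refine soloInformed_per_mem_span_of_pderiv_pos rq P hR (fun z hz => ?_) fun z _ => by rw [hP]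
    rw [hP]
    have h := abs_lt.1 (hM z hz)
    simp only [map_add, MvPolynomial.aeval_C, eq_ratCast, Rat.cast_natCast]
    linarith [h.1]
  have hMmem : soloInformedPer rM ∈ soloInformedKappaSpan := by
    refine soloInformed_per_mem_span_of_pderiv_pos rM (MvPolynomial.C (M : ℚ) * MvPolynomial.X 1)
      hR (fun z _ => ?_) fun z _ => ?_
    · simpa using hM0
    · simp [rM]
  have hPer : soloInformedPer r = soloInformedPer rq - soloInformedPer rM :=
    eq_sub_of_add_eq (soloInformedPer_add hadd).symm
  rw [hPer]
  exact sub_mem hq hMmem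

/-- **Piecewise-polynomial weights.** If on its domain the integrand of `r` (dimension two) agrees
with a polynomial `pᵢ ∈ ℚ[x, y]` on each of finitely many bounded `ℚ`-semialgebraic pieces `Dᵢ`
meeting pairwise in null sets, and vanishes off `⋃ Dᵢ`, then `Per r` lies in the curve sector
(rule (1) and Theorem XVI-P piece by piece). [Kontsevich–Zagier 2001, §1.2, rule (1)] -/
theorem soloInformed_per_mem_span_piecewisePoly {ι : Type*} (s : Finset ι) (r : IntegralRep 2)
    (D : ι → Set (Fin 2 → ℝ)) (hD : ∀ i ∈ s, IsSemialgebraic ℚ (D i))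
    (hDb : ∀ i ∈ s, Bornology.IsBounded (D i))
    (hdisj : (s : Set ι).Pairwise fun i j => volume (D i ∩ D j) = 0)
    (p : ι → MvPolynomial (Fin 2) ℚ)
    (hp : ∀ i ∈ s, ∀ z ∈ r.domain ∩ D i, r.integrand z = MvPolynomial.aeval z (p i))
    (h0 : ∀ z ∈ r.domain, z ∉ (⋃ i ∈ s, D i) → r.integrand z = 0) :
    soloInformedPer r ∈ soloInformedKappaSpan := by
  classical
  have hU : IsSemialgebraic ℚ (⋃ i ∈ s, D i) := IsSemialgebraic.biUnion s D hD
  have h1sa : IsSemialgebraic ℚ (r.domain ∩ ⋃ i ∈ s, D i) := r.isSemialgebraic_domain.inter hU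
  have h0sa : IsSemialgebraic ℚ (r.domain \ ⋃ i ∈ s, D i) := r.isSemialgebraic_domain.diff hU
  set r₁ := r.restrict _ h1sa inter_subset_left with hr₁
  set r₀ := r.restrict _ h0sa Set.sdiff_subset with hr₀
  -- `[r] ≡ [r₁] + [r₀]`, and `[r₀]` is a relation
  have e1 : of r - of r₁ - of r₀ ∈ relations := by
    refine domainAddRel_subset_relations ⟨2, r, r₁, r₀, ?_, ?_, fun _ _ => rfl, fun _ _ => rfl, rfl⟩
    · rw [hr₁, hr₀, IntegralRep.domain_restrict, IntegralRep.domain_restrict, Set.inter_union_sdiff]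
    · rw [hr₁, hr₀, IntegralRep.domain_restrict, IntegralRep.domain_restrict]
      exact measure_mono_null (fun z hz => (hz.2.2 hz.1.2).elim) measure_empty
  have e0 : of r₀ ∈ relations :=
    of_mem_relations_of_eqOn_zero r₀ fun z hz => h0 z hz.1 hz.2
  have hPer0 : soloInformedPer r₀ ∈ soloInformedKappaSpan :=
    soloInformed_mk_mem_span_of_mem_relations e0
  -- `[r₁] ≡ Σᵢ [r|_{Dᵢ}]`
  have hisa : ∀ i : ι, i ∈ s → IsSemialgebraic ℚ (r.domain ∩ D i) := fun i hi =>
    r.isSemialgebraic_domain.inter (hD i hi)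
  let Rp : ι → IntegralRep 2 := fun i =>
    if hi : i ∈ s then r.restrict _ (hisa i hi) inter_subset_left else r
  have hRp : ∀ i (hi : i ∈ s), Rp i = r.restrict _ (hisa i hi) inter_subset_left :=
    fun i hi => by simp only [Rp, dif_pos hi]
  have hRpd : ∀ i ∈ s, (Rp i).domain = r.domain ∩ D i := fun i hi => by
    rw [hRp i hi, IntegralRep.domain_restrict]
  have e2 : of r₁ - ∑ i ∈ s, of (Rp i) ∈ relations := by
    refine of_sub_sum_of_mem_relations s r₁ Rp (fun i hi => ?_) (fun i hi z _ => ?_) ?_ ?_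
    · rw [hRpd i hi, hr₁, IntegralRep.domain_restrict]
      exact measure_mono_null (fun z hz => (hz.2 ⟨hz.1.1, mem_biUnion hi hz.1.2⟩).elim)
        measure_empty
    · rw [hRp i hi, hr₁, IntegralRep.integrand_restrict, IntegralRep.integrand_restrict]
    · rw [hr₁, IntegralRep.domain_restrict]
      refine measure_mono_null (fun z hz => ?_) measure_empty
      obtain ⟨⟨hzr, hzU⟩, hzn⟩ := hz
      obtain ⟨i, hi, hzi⟩ := mem_iUnion₂.1 hzU
      exact (hzn (mem_iUnion₂.2 ⟨i, hi, by rw [hRpd i hi]; exact ⟨hzr, hzi⟩⟩)).elim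
    · intro i hi j hj hne
      rw [hRpd i hi, hRpd j hj]
      refine measure_mono_null (fun z hz => ?_) (hdisj hi hj hne)
      exact ⟨hz.1.2, hz.2.2⟩
  have hPer1 : soloInformedPer r₁ ∈ soloInformedKappaSpan := by
    rw [soloInformedPer_sum s e2]
    refine sum_mem fun i hi => ?_
    rw [hRp i hi]
    exact soloInformed_per_mem_span_poly _ ((hDb i hi).subset inter_subset_right) (p i)
      fun z hz => hp i hi z hz
  rw [soloInformedPer_add e1]
  exact add_mem hPer1 hPer0

/-- One piece: integrand a polynomial `p` on `r.domain ∩ D` (`D` bounded `ℚ`-semialgebraic) and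
`0` on `r.domain \ D`. -/
theorem soloInformed_per_mem_span_poly_on (r : IntegralRep 2) {D : Set (Fin 2 → ℝ)}
    (hD : IsSemialgebraic ℚ D) (hDb : Bornology.IsBounded D) (p : MvPolynomial (Fin 2) ℚ)
    (hp : ∀ z ∈ r.domain ∩ D, r.integrand z = MvPolynomial.aeval z p)
    (h0 : ∀ z ∈ r.domain, z ∉ D → r.integrand z = 0) :
    soloInformedPer r ∈ soloInformedKappaSpan := by
  refine soloInformed_per_mem_span_piecewisePoly (Finset.univ : Finset Unit) r (fun _ => D)
    (fun _ _ => hD) (fun _ _ => hDb) (Set.subsingleton_of_subsingleton.pairwise _) (fun _ => p)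
    (fun _ _ z hz => hp z hz) fun z hz hz' => h0 z hz ?_
  simpa using hz'

end Summit.KontsevichZagierPeriods.KontsevichZagierPeriods.Theorems
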